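import Summits.CriticalPhenomena.PercolationContinuityZ3.Theorems.PercNearOneGluingAdditiveGluingTwoStepGlue
import HarnessLib

/-!
# Crux `PercNearOneGluing.AdditiveGluing` (stmt-CriticalPhenomena-4576): an UNCONDITIONAL part of the three-relay case —
# CAG(3) whenever the observer's pair-pivotality exceeds the spectator's by at most the room ("gain gap")

Support file (`--supports stmt-CriticalPhenomena-4576`; task png-dp-al5, memo TWOSTEP-GLUE.md).  No definitions, no named facts, no sorries.
Notation of `…TwoStepGlue.lean`: pair `{a₁,a₂}` glued, spectator `c`, `θ ≤ τ_{a₁}, τ_{a₂}`, `G_x = μ((x↔b)ᶜ ∩ (x↔a₁ ∪ x↔a₂) ∩ (a₁↔b ∪ a₂↔b))`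
(the pair is pivotal for `x ↔ b`), `ROOM₁ = μ(oAᶜ ∩ (a₁↔b ∪ a₂↔b) ∩ (c↔b)ᶜ ∩ N)`, `N = {c↮a₁} ∩ {c↮a₂}`.

**Theorem (`twoStep_cag3_of_gainGap`).**  If `G_o − G_c ≤ ROOM₁ + (τ_c − θ)` then CAG(3):
`μ(oA ∩ (o↔b)ᶜ ∩ Ab) ≤ μ(Ab) − θ`.  Proof: the two-step gluing chain of `…TwoStepGlue.lean` with Kozma–Nitzan's Theorem 1 in its
MIN form (`KNPreFKG.preFKG_pair`) in the glued weighting: the branch "`F_v` minimal" closes by Kozma–Nitzan's Lemma 4 (`knLemma4_pair`)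
without any hypothesis, the branch "`F_c` minimal" needs exactly the gain-gap hypothesis.  At a full tie this covers the three-relay E-form
whenever `G_o(e) − G_{a_j}(e) ≤ ROOM₁(e)` for SOME pair `e` (numerically ≈ 97 % of the all-bad tied instances of the line, memo §2);
the remaining instances need the weighted form ((★★) / `stub_v3prime_dp`).  Corollary `twoStep_threeRelays_eform_of_gainGap`.
[cite: KozmaNitzan2024, Theorem 1 (pp. 7–8), Lemma 4 (p. 9), Question 7 (p. 36)]
-/

namespace Summit.CriticalPhenomena.PercolationContinuityZ3.Theorems

open MeasureTheory Set Literature.Probability.LatticeModels Literature.Probability.Percolation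

noncomputable section
open Classical

variable {n : ℕ}

/-- **CAG(3) under the gain-gap hypothesis** `G_o − G_c ≤ ROOM₁ + (τ_c − θ)` (see the file header; unconditional otherwise).
[cite: KozmaNitzan2024, Theorem 1 (pp. 7–8), Lemma 4 (p. 9)] -/
theorem twoStep_cag3_of_gainGap (w : Sym2 (Fin n) → unitInterval) (o b a₁ a₂ c : Fin n) (h12 : a₁ ≠ a₂) (θ : ℝ)
    (hθ1 : θ ≤ (prodBernoulli w).real (openConn a₁ b)) (hθ2 : θ ≤ (prodBernoulli w).real (openConn a₂ b))
    (hgap :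
      (prodBernoulli w).real ((openConn o b)ᶜ ∩ (openConn o a₁ ∪ openConn o a₂) ∩ (openConn a₁ b ∪ openConn a₂ b)) -
          (prodBernoulli w).real ((openConn c b)ᶜ ∩ (openConn c a₁ ∪ openConn c a₂) ∩ (openConn a₁ b ∪ openConn a₂ b)) ≤
        (prodBernoulli w).real ((openConn o a₁ ∪ openConn o a₂ ∪ openConn o c)ᶜ ∩ (openConn a₁ b ∪ openConn a₂ b) ∩
            (openConn c b)ᶜ ∩ ((openConn c a₁)ᶜ ∩ (openConn c a₂)ᶜ)) +
          ((prodBernoulli w).real (openConn c b) - θ)) :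
    (prodBernoulli w).real ((openConn o a₁ ∪ openConn o a₂ ∪ openConn o c) ∩ (openConn o b)ᶜ ∩
        (openConn a₁ b ∪ openConn a₂ b ∪ openConn c b)) ≤
      (prodBernoulli w).real (openConn a₁ b ∪ openConn a₂ b ∪ openConn c b) - θ := by
  set μ := prodBernoulli w with hμ
  have hm : ∀ s : Set (BondConfig (Fin n)), MeasurableSet s := fun _ => MeasurableSet.of_discrete
  set O₁ : Set (BondConfig (Fin n)) := openConn o a₁ with hO₁
  set O₂ : Set (BondConfig (Fin n)) := openConn o a₂ with hO₂
  set Oc : Set (BondConfig (Fin n)) := openConn o c with hOc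
  set Ob : Set (BondConfig (Fin n)) := openConn o b with hOb
  set B₁ : Set (BondConfig (Fin n)) := openConn a₁ b with hB₁
  set B₂ : Set (BondConfig (Fin n)) := openConn a₂ b with hB₂
  set Bc : Set (BondConfig (Fin n)) := openConn c b with hBc
  set C₁ : Set (BondConfig (Fin n)) := openConn c a₁ with hC₁
  set C₂ : Set (BondConfig (Fin n)) := openConn c a₂ with hC₂
  -- Theorem 1 (min form) in the glued weighting, converted with the EF identities and pulled back
  have hT := KNPreFKG.preFKG_pair (Function.update w s(a₁, a₂) 1) o b a₁ c
  have hE1 := twoStep_EF_identity (Function.update w s(a₁, a₂) 1) o b a₁ c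
  have hE2 := twoStep_EF_identity (Function.update w s(a₁, a₂) 1) o b c a₁
  have hu1 : (openConn o c ∪ openConn o a₁ : Set (BondConfig (Fin n))) = openConn o a₁ ∪ openConn o c :=
    Set.union_comm _ _
  have hu2 : (openConn c b ∪ openConn a₁ b : Set (BondConfig (Fin n))) = openConn a₁ b ∪ openConn c b :=
    Set.union_comm _ _
  rw [hu1, hu2] at hE2
  rw [twoStep_glue_gain w h12 o b c, twoStep_glue_Tc w h12 o b c] at hE1
  rw [twoStep_glue_gain w h12 o b c, twoStep_glue_Ta w h12 o b c] at hE2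
  simp only [← hμ, ← hO₁, ← hO₂, ← hOc, ← hOb, ← hB₁, ← hB₂, ← hBc, ← hC₁, ← hC₂] at hT hE1 hE2 hgap ⊢
  -- identities in `w` (as in `twoStep_cag3`)
  have hd1 : μ.real ((O₁ ∪ O₂ ∪ Oc) ∩ Obᶜ ∩ (B₁ ∪ B₂ ∪ Bc)) =
      μ.real (Obᶜ ∩ (O₁ ∪ O₂) ∩ (B₁ ∪ B₂)) +
        μ.real ((O₁ ∪ O₂ ∪ Oc) ∩ Obᶜ ∩ ((O₁ ∪ O₂) ∩ (B₁ ∪ B₂))ᶜ ∩ (B₁ ∪ B₂ ∪ Bc)) := by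
    have h := measureReal_inter_add_sdiff (μ := μ) (s := (O₁ ∪ O₂ ∪ Oc) ∩ Obᶜ ∩ (B₁ ∪ B₂ ∪ Bc))
      (hm ((O₁ ∪ O₂) ∩ (B₁ ∪ B₂)))
    have e1 : (O₁ ∪ O₂ ∪ Oc) ∩ Obᶜ ∩ (B₁ ∪ B₂ ∪ Bc) ∩ ((O₁ ∪ O₂) ∩ (B₁ ∪ B₂)) =
        Obᶜ ∩ (O₁ ∪ O₂) ∩ (B₁ ∪ B₂) := by
      ext ω; simp only [Set.mem_inter_iff, Set.mem_union, Set.mem_compl_iff]; tauto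
    have e2 : ((O₁ ∪ O₂ ∪ Oc) ∩ Obᶜ ∩ (B₁ ∪ B₂ ∪ Bc)) \ ((O₁ ∪ O₂) ∩ (B₁ ∪ B₂)) =
        (O₁ ∪ O₂ ∪ Oc) ∩ Obᶜ ∩ ((O₁ ∪ O₂) ∩ (B₁ ∪ B₂))ᶜ ∩ (B₁ ∪ B₂ ∪ Bc) := by
      ext ω; simp only [Set.mem_sdiff, Set.mem_inter_iff, Set.mem_compl_iff]; tauto
    rw [e1, e2] at h
    linarith
  have hd2 : μ.real ((O₁ ∪ O₂ ∪ Oc) ∩ Bc ∩ (B₁ ∪ B₂)ᶜ) ≤ μ.real (B₁ ∪ B₂ ∪ Bc) - μ.real (B₁ ∪ B₂) := by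
    have h := measureReal_inter_add_sdiff (μ := μ) (s := B₁ ∪ B₂ ∪ Bc) (hm (B₁ ∪ B₂))
    have e1 : (B₁ ∪ B₂ ∪ Bc) ∩ (B₁ ∪ B₂) = B₁ ∪ B₂ := Set.inter_eq_right.2 Set.subset_union_left
    have e2 : (B₁ ∪ B₂ ∪ Bc) \ (B₁ ∪ B₂) = Bc ∩ (B₁ ∪ B₂)ᶜ := by
      ext ω; simp only [Set.mem_sdiff, Set.mem_inter_iff, Set.mem_union, Set.mem_compl_iff]; tauto
    rw [e1, e2] at h
    have h' : μ.real ((O₁ ∪ O₂ ∪ Oc) ∩ Bc ∩ (B₁ ∪ B₂)ᶜ) ≤ μ.real (Bc ∩ (B₁ ∪ B₂)ᶜ) :=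
      measureReal_mono (fun ω hω => ⟨hω.1.2, hω.2⟩) (measure_ne_top _ _)
    linarith
  have hd3 : μ.real ((O₁ ∪ O₂ ∪ Oc) ∩ (B₁ ∪ B₂) ∩ Bcᶜ ∩ (C₁ᶜ ∩ C₂ᶜ)) =
      μ.real (B₁ ∪ B₂ ∪ Bc) - μ.real Bc - μ.real (Bcᶜ ∩ (C₁ ∪ C₂) ∩ (B₁ ∪ B₂)) -
        μ.real ((O₁ ∪ O₂ ∪ Oc)ᶜ ∩ (B₁ ∪ B₂) ∩ Bcᶜ ∩ (C₁ᶜ ∩ C₂ᶜ)) := by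
    have h := measureReal_inter_add_sdiff (μ := μ) (s := B₁ ∪ B₂ ∪ Bc) (hm Bc)
    have e1 : (B₁ ∪ B₂ ∪ Bc) ∩ Bc = Bc := Set.inter_eq_right.2 Set.subset_union_right
    have e2 : (B₁ ∪ B₂ ∪ Bc) \ Bc = (B₁ ∪ B₂) ∩ Bcᶜ := by
      ext ω; simp only [Set.mem_sdiff, Set.mem_inter_iff, Set.mem_union, Set.mem_compl_iff]; tauto
    rw [e1, e2] at h
    have h' := measureReal_inter_add_sdiff (μ := μ) (s := (B₁ ∪ B₂) ∩ Bcᶜ) (hm (C₁ᶜ ∩ C₂ᶜ))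
    have e4 : ((B₁ ∪ B₂) ∩ Bcᶜ) \ (C₁ᶜ ∩ C₂ᶜ) = Bcᶜ ∩ (C₁ ∪ C₂) ∩ (B₁ ∪ B₂) := by
      ext ω; simp only [Set.mem_sdiff, Set.mem_inter_iff, Set.mem_union, Set.mem_compl_iff]; tauto
    rw [e4] at h'
    have h'' := measureReal_inter_add_sdiff (μ := μ) (s := (B₁ ∪ B₂) ∩ Bcᶜ ∩ (C₁ᶜ ∩ C₂ᶜ)) (hm (O₁ ∪ O₂ ∪ Oc))
    have e5 : (B₁ ∪ B₂) ∩ Bcᶜ ∩ (C₁ᶜ ∩ C₂ᶜ) ∩ (O₁ ∪ O₂ ∪ Oc) =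
        (O₁ ∪ O₂ ∪ Oc) ∩ (B₁ ∪ B₂) ∩ Bcᶜ ∩ (C₁ᶜ ∩ C₂ᶜ) := by
      ext ω; simp only [Set.mem_inter_iff]; tauto
    have e6 : ((B₁ ∪ B₂) ∩ Bcᶜ ∩ (C₁ᶜ ∩ C₂ᶜ)) \ (O₁ ∪ O₂ ∪ Oc) =
        (O₁ ∪ O₂ ∪ Oc)ᶜ ∩ (B₁ ∪ B₂) ∩ Bcᶜ ∩ (C₁ᶜ ∩ C₂ᶜ) := by
      ext ω; simp only [Set.mem_sdiff, Set.mem_inter_iff, Set.mem_compl_iff]; tauto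
    rw [e5, e6] at h''
    linarith
  -- Kozma–Nitzan Lemma 4 in `w` for the pair
  have hL4 := knLemma4_pair w o a₁ a₂ b
  simp only [← hμ, ← hO₁, ← hO₂, ← hOb, ← hB₁, ← hB₂] at hL4
  have hmin : θ ≤ min (μ.real B₁) (μ.real B₂) := le_min hθ1 hθ2
  rw [hd1]
  rcases min_le_iff.1 hT with h1 | h2
  · -- `F_{a₁}` minimal: `Gain¹(o) ≤ T_c`
    have hG : μ.real ((O₁ ∪ O₂ ∪ Oc) ∩ Obᶜ ∩ ((O₁ ∪ O₂) ∩ (B₁ ∪ B₂))ᶜ ∩ (B₁ ∪ B₂ ∪ Bc)) ≤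
        μ.real ((O₁ ∪ O₂ ∪ Oc) ∩ Bc ∩ (B₁ ∪ B₂)ᶜ) := by linarith
    linarith
  · -- `F_c` minimal: `Gain¹(o) ≤ T_{a₁}`; the gain-gap hypothesis closes
    have hG : μ.real ((O₁ ∪ O₂ ∪ Oc) ∩ Obᶜ ∩ ((O₁ ∪ O₂) ∩ (B₁ ∪ B₂))ᶜ ∩ (B₁ ∪ B₂ ∪ Bc)) ≤
        μ.real ((O₁ ∪ O₂ ∪ Oc) ∩ (B₁ ∪ B₂) ∩ Bcᶜ ∩ (C₁ᶜ ∩ C₂ᶜ)) := by linarith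
    rw [hd3] at hG
    linarith

/-- **The three-relay E-form under the gain-gap hypothesis** (`θ = 1 − t`): for relays `a₁ ≠ a₂`, `a₃` with `1 − t ≤ τ_{a₁}, τ_{a₂}`,
if `G_o − G_{a₃} ≤ ROOM₁ + (τ_{a₃} − (1 − t))` for the pair `{a₁,a₂}` then `μ((o↔a₁ ∪ o↔a₂ ∪ o↔a₃) ∖ o↔b) ≤ t`.
[cite: KozmaNitzan2024, Question 7 (p. 36)] -/
theorem twoStep_threeRelays_eform_of_gainGap (w : Sym2 (Fin n) → unitInterval) (o b a₁ a₂ a₃ : Fin n) (t : ℝ)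
    (h12 : a₁ ≠ a₂)
    (ht1 : 1 - t ≤ (prodBernoulli w).real (openConn a₁ b)) (ht2 : 1 - t ≤ (prodBernoulli w).real (openConn a₂ b))
    (hgap :
      (prodBernoulli w).real ((openConn o b)ᶜ ∩ (openConn o a₁ ∪ openConn o a₂) ∩ (openConn a₁ b ∪ openConn a₂ b)) -
          (prodBernoulli w).real ((openConn a₃ b)ᶜ ∩ (openConn a₃ a₁ ∪ openConn a₃ a₂) ∩ (openConn a₁ b ∪ openConn a₂ b)) ≤
        (prodBernoulli w).real ((openConn o a₁ ∪ openConn o a₂ ∪ openConn o a₃)ᶜ ∩ (openConn a₁ b ∪ openConn a₂ b) ∩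
            (openConn a₃ b)ᶜ ∩ ((openConn a₃ a₁)ᶜ ∩ (openConn a₃ a₂)ᶜ)) +
          ((prodBernoulli w).real (openConn a₃ b) - (1 - t))) :
    (prodBernoulli w).real ((openConn o a₁ ∪ openConn o a₂ ∪ openConn o a₃) \ openConn o b) ≤ t := by
  have hcag := twoStep_cag3_of_gainGap w o b a₁ a₂ a₃ h12 (1 - t) ht1 ht2 hgap
  have hm : ∀ s : Set (BondConfig (Fin n)), MeasurableSet s := fun _ => MeasurableSet.of_discrete
  set μ := prodBernoulli w with hμ
  set oA : Set (BondConfig (Fin n)) := openConn o a₁ ∪ openConn o a₂ ∪ openConn o a₃ with hoA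
  set Ab : Set (BondConfig (Fin n)) := openConn a₁ b ∪ openConn a₂ b ∪ openConn a₃ b with hAb
  have h1 := measureReal_inter_add_sdiff (μ := μ) (s := oA \ openConn o b) (hm Ab)
  have e1 : (oA \ openConn o b) ∩ Ab = oA ∩ (openConn o b)ᶜ ∩ Ab := by rw [Set.sdiff_eq]
  have h2 : μ.real ((oA \ openConn o b) \ Ab) ≤ μ.real Abᶜ := measureReal_mono (fun ω hω => hω.2) (measure_ne_top _ _)
  have h3 : μ.real Abᶜ = 1 - μ.real Ab := probReal_compl_eq_one_sub (hm _)
  rw [e1] at h1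
  linarith

end

end Summit.CriticalPhenomena.PercolationContinuityZ3.Theorems
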